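import Mathlib
import Summits.KontsevichZagierPeriods.Zeta5Search.Elimination.DiagonalPartner
import HarnessLib

/-!
# ζ(5) search — class `elim`: THE SECOND SHELL — every partner `b + e_i + e_j` (and the stride-two diagonal partner
# `b⁺⁺`) gives a FIXED rational combination of Brown–Zudilin's eliminants at `b` and at `b⁺`
# (cell `pub-zeta5`, fam-elim, E-L13; add-on to E-L10/E-L11/E-L12 over the D2 lane's relation (DS))

HONEST FRAMING: systematic search; no irrationality claim unless certified.

OUR work (Summit side; `families/elim/FAMILY.md` §17.11).  Notation as in E-L10/E-L12: `v(x) = (U, W, V)(x) ∈ ℚ³` is the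
coefficient vector of the dual Brown–Zudilin form `F̃₇(x) = U(x)ζ(5) + W(x)ζ(3) − V(x)` (`WedgeDictionary.vwp_decomposition`),
`up x i = x + e_{i+1}` (slot `i < 7`), `x⁺ = dsShift x = (x₀+2; x₁+1, …, x₇+1)` the diagonal translate, `λ_i(x) = dsLam x i`.
E-L10 proved that the FIRST shell `{b + e_{i+1}}` lies in one plane `Π(b)` through `v(b)`; E-L12 that `Π(b) = ⟨v(b), v(b⁺)⟩`
(`v(b + e_{i+1}) = v(b⁺) + λ_i(b)·v(b)`) and that the diagonal pair `(b, b⁺)` IS Brown–Zudilin's contiguous pair (same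
minors, same `ζ(3)`-eliminant `partnerElim`).  E-L12 left open the pairs it could not reach: the SECOND shell `b + e_i + e_j`
and the stride-two diagonal partner `b⁺⁺` — the remaining partners `b + e`, `|e| ≤ 2`, of gen-1's exact partner atlas
(FAMILY.md §3.5–§3.7: 'partner choice immaterial', same RATES, by exact arithmetic to `n ≤ 120`).  This file settles them
at the level of IDENTITIES.  For `b` in the box with `d(b) = dOf b ≥ 1` and admissible slots (`b_{j+1} ≤ b₀`,
`(b + e_{j+1})_{i+1} ≤ b₀`; `i = j` allowed):

* `dictionary_up_up`, `typeI_up_up` — **second-shell expansion in the diagonal frame**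
  `v(b + e_{i+1} + e_{j+1}) = v(b⁺⁺) + A_{ij}(b)·v(b⁺) + B_{ij}(b)·v(b)` with the explicit integers
  `A_{ij} = λ_j(b⁺) + λ_i(b + e_{j+1})` (`secA`), `B_{ij} = λ_i(b + e_{j+1})·λ_j(b)` (`secB`); for `i ≠ j`:
  `A_{ij} = λ_i(b) + λ_j(b) + b₀ + 3`, `B_{ij} = λ_i(b)λ_j(b)` (`secA_eq_of_ne`, `secB_eq_of_ne`) — three applications of (DS);
* `det_shells_eq_diagCasoratian` — **all triples (base, first-shell point, second-shell point) have ONE determinant**, the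
  diagonal Casoratian `det[v(b), v(b⁺), v(b⁺⁺)]` (`diagCasoratian`; unitriangular change of frame): the `k = 3` object of
  E-L9's determinant envelope, not a new `2 × 2` road;
* `pairMinorQ_up_up`, `pairMinorPhat_up_up`, `pairMinorP_up_up`, `pairElim_up_up` — the three `2 × 2` minors and the
  `ζ(3)`-eliminant of the second-shell PAIR `(b, b + e_{i+1} + e_{j+1})` are those of the stride-two diagonal pair `(b, b⁺⁺)`
  plus `A_{ij}` times Brown–Zudilin's (`diagMinorQ b = minorQ b ·`, E-L12);
* `plucker_pairElim`, `plucker_pairMinorQ`, `plucker_pairMinorP` — the three-term (Plücker) identities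
  `W(b⁺)·E(b, b⁺⁺) = W(b⁺⁺)·E(b, b⁺) + W(b)·E(b⁺, b⁺⁺)` (pure algebra, no hypotheses), where by E-L12
  `E(b, b⁺) = partnerElim b ·` and `E(b⁺, b⁺⁺) = partnerElim b⁺ ·`;
* `secondShell_elim_eq`, `strideTwo_elim_eq` — **conclusion**: for every second-shell partner and for `b⁺⁺`,
  `W(b⁺) · [W(b′)F̃₇(b) − W(b)F̃₇(b′)] = c₁ · partnerElim b j + c₂ · partnerElim b⁺ j` with the explicit rational weights
  `c₁ = W(b⁺⁺) + A_{ij}W(b⁺)` (resp. `W(b⁺⁺)`), `c₂ = W(b)`: as linear forms in `1, ζ(5)` these eliminants lie in the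
  `ℚ`-span of Brown–Zudilin's two-term forms at the two consecutive diagonal points `b, b⁺` (whenever `W(b⁺) ≠ 0`), with
  weights of the size of the coefficients themselves — consistent with the atlas (same rates) and with THEOREM P1/P2′
  (no rate can improve); `pairElim_eq` records that every pair eliminant of two in-box shapes is `ζ(3)`-free with the pair's
  own minors as coefficients.

Reading for the class (T4, structural): together with E-L10 (first shell: ONE number) and E-L12 (diagonal partner: the SAME
number) this closes the `|e| ≤ 2` up-shell of partners at kernel level — no partner of the Brown–Zudilin module within two
unit steps of `b` produces a `ζ(3)`-free form outside `ℚ·(Q(b)ζ(5) − P(b)) + ℚ·(Q(b⁺)ζ(5) − P(b⁺))`.  What this is NOT: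
anything about sizes, denominators, valuations or irrationality; down-shifts `b − e_i` and shifts of `b₀` alone are not
treated (they leave the hypotheses of (DS)).  The division form (membership in the `ℚ`-span when `W(b⁺) ≠ 0`) and the
specialisation to Brown–Zudilin's symmetric ray `(3n; n⁷)` — whose second partner `(3n; n+2, n⁶)` is the `bRay''` of
`SymRaySecondPartner` — are in the companion file `Elimination/SecondShellRay.lean`.
-/

noncomputable section

open Finset

namespace Summit.KontsevichZagierPeriods.Zeta5Search.Elimination

open Summit.KontsevichZagierPeriods.Zeta5Search.DualSeries (InBox)
open Summit.KontsevichZagierPeriods.Zeta5Search.WedgeDictionary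
open Literature.NumberTheory.Irrationality.BrownZudilin2022 (vwpDual)
open Literature.NumberTheory.Transcendental (zetaValue)

/-! ### Bookkeeping for the up-shift and the diagonal shift -/

/-- The up-shift does not touch the leading entry: `(b + e_{j+1})₀ = b₀`. -/
theorem up_zero (b : ℕ → ℤ) (j : ℕ) : up b j 0 = b 0 := Function.update_of_ne (by omega) _ _

/-- The shifted slot: `(b + e_{j+1})_{j+1} = b_{j+1} + 1`. -/
theorem up_self (b : ℕ → ℤ) (j : ℕ) : up b j (j + 1) = b (j + 1) + 1 := Function.update_self _ _ _

/-- The other slots: `(b + e_{j+1})_{k+1} = b_{k+1}` for `k ≠ j`. -/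
theorem up_of_ne {b : ℕ → ℤ} {j k : ℕ} (h : k ≠ j) : up b j (k + 1) = b (k + 1) :=
  Function.update_of_ne (by omega) _ _

/-- The excess drops by one under an up-shift: `d(b + e_{j+1}) = d(b) − 1`. -/
theorem dOf_up (b : ℕ → ℤ) {j : ℕ} (hj : j ∈ range 7) : dOf (up b j) = dOf b - 1 := by
  unfold dOf up
  rw [DualSeries.sum_update b hj, Function.update_of_ne (show (0 : ℕ) ≠ j + 1 by omega)]
  ring

/-- The diagonal shift commutes with the up-shifts: `(b + e_{j+1})⁺ = b⁺ + e_{j+1}`. -/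
theorem dsShift_up (b : ℕ → ℤ) (j : ℕ) : dsShift (up b j) = up (dsShift b) j := by
  funext k
  rcases k with _ | m
  · simp only [dsShift_zero, up_zero]
  · by_cases h : m = j
    · subst h; simp only [dsShift_succ, up_self]
    · simp only [dsShift_succ, up_of_ne h]

/-- For `i ≠ j` the coefficient `λ_i` does not see the shift in slot `j+1`: `λ_i(b + e_{j+1}) = λ_i(b)`. -/
theorem dsLam_up_of_ne (b : ℕ → ℤ) {i j : ℕ} (h : i ≠ j) : dsLam (up b j) i = dsLam b i := by
  unfold dsLam; rw [up_of_ne h, up_zero]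

/-- In the shifted slot: `λ_j(b + e_{j+1}) = (b_{j+1} + 2)(b₀ − b_{j+1})`. -/
theorem dsLam_up_self (b : ℕ → ℤ) (j : ℕ) :
    dsLam (up b j) j = ((b (j + 1) : ℚ) + 2) * ((b 0 : ℚ) - (b (j + 1) : ℚ)) := by
  unfold dsLam; rw [up_self, up_zero]; push_cast; ring

/-- Along the diagonal: `λ_j(b⁺) = λ_j(b) + b₀ + 3` (independent of `j` in the increment). -/
theorem dsLam_dsShift (b : ℕ → ℤ) (j : ℕ) : dsLam (dsShift b) j = dsLam b j + ((b 0 : ℚ) + 3) := by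
  unfold dsLam; rw [dsShift_succ, dsShift_zero]; push_cast; ring

/-! ### The hypotheses of (DS) at the three points `b`, `b + e_{j+1}`, `b⁺` -/

/-- (DS) is available at `b⁺` in every slot as soon as `d(b) ≥ 1`. -/
theorem ds_hyps_dsShift (b : ℕ → ℤ) (hb : InBox b) (hd : 1 ≤ dOf b) {j : ℕ} (hj : j ∈ range 7) :
    InBox (dsShift b) ∧ 0 ≤ dOf (dsShift b) ∧ dsShift b (j + 1) ≤ dsShift b 0 := by
  refine ⟨inBox_dsShift hb, by rw [dOf_dsShift]; omega, ?_⟩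
  rw [dsShift_succ, dsShift_zero]
  have := (hb.2 j hj).2
  omega

/-- (DS) is available at `b + e_{j+1}` in slot `i+1` when `d(b) ≥ 1` and `(b + e_{j+1})_{i+1} ≤ b₀`. -/
theorem ds_hyps_up (b : ℕ → ℤ) (hb : InBox b) (hd : 1 ≤ dOf b) {i j : ℕ} (hj : j ∈ range 7)
    (hlj : b (j + 1) ≤ b 0) (hli : up b j (i + 1) ≤ b 0) :
    InBox (up b j) ∧ 0 ≤ dOf (up b j) ∧ up b j (i + 1) ≤ up b j 0 :=
  ⟨(box_up b hb (by omega) hj hlj).1, by rw [dOf_up b hj]; omega, by rwa [up_zero]⟩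

/-! ### The second shell in the diagonal frame -/

/-- `A_{ij}(b) = λ_j(b⁺) + λ_i(b + e_{j+1})`, the `v(b⁺)`-coefficient of `v(b + e_{i+1} + e_{j+1})`. -/
def secA (b : ℕ → ℤ) (i j : ℕ) : ℚ := dsLam (dsShift b) j + dsLam (up b j) i

/-- `B_{ij}(b) = λ_i(b + e_{j+1})·λ_j(b)`, the `v(b)`-coefficient of `v(b + e_{i+1} + e_{j+1})`. -/
def secB (b : ℕ → ℤ) (i j : ℕ) : ℚ := dsLam (up b j) i * dsLam b j

/-- Off the diagonal the second-shell coefficients are symmetric polynomials in `λ_i, λ_j`: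
`A_{ij} = λ_i + λ_j + b₀ + 3`. -/
theorem secA_eq_of_ne (b : ℕ → ℤ) {i j : ℕ} (h : i ≠ j) :
    secA b i j = dsLam b i + dsLam b j + ((b 0 : ℚ) + 3) := by
  unfold secA; rw [dsLam_dsShift, dsLam_up_of_ne _ h]; ring

/-- `B_{ij} = λ_i·λ_j` for `i ≠ j`. -/
theorem secB_eq_of_ne (b : ℕ → ℤ) {i j : ℕ} (h : i ≠ j) : secB b i j = dsLam b i * dsLam b j := by
  unfold secB; rw [dsLam_up_of_ne _ h]

/-- In particular `A_{ij} = A_{ji}` (`i ≠ j`), as it must be (`b + e_{i+1} + e_{j+1}` is symmetric in `i, j`) … -/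
theorem secA_comm (b : ℕ → ℤ) {i j : ℕ} (h : i ≠ j) : secA b i j = secA b j i := by
  rw [secA_eq_of_ne _ h, secA_eq_of_ne _ (Ne.symm h)]; ring

/-- … and `B_{ij} = B_{ji}` (`i ≠ j`). -/
theorem secB_comm (b : ℕ → ℤ) {i j : ℕ} (h : i ≠ j) : secB b i j = secB b j i := by
  rw [secB_eq_of_ne _ h, secB_eq_of_ne _ (Ne.symm h)]; ring

/-- On the diagonal of the shell (`b + 2e_{j+1}`): `A_{jj} = 2(b_{j+1}+2)(b₀−b_{j+1}+1)`. -/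
theorem secA_self (b : ℕ → ℤ) (j : ℕ) :
    secA b j j = 2 * ((b (j + 1) : ℚ) + 2) * ((b 0 : ℚ) - (b (j + 1) : ℚ) + 1) := by
  unfold secA; rw [dsLam_dsShift, dsLam_up_self]; unfold dsLam; ring

/-- **Second-shell expansion, coefficientwise:** for `X ∈ {U, W, V}`,
`X(b + e_{i+1} + e_{j+1}) = X(b⁺⁺) + A_{ij}·X(b⁺) + B_{ij}·X(b)`. -/
theorem dictionary_up_up (b : ℕ → ℤ) (hb : InBox b) (hd : 1 ≤ dOf b) {i j : ℕ} (hi : i ∈ range 7)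
    (hj : j ∈ range 7) (hlj : b (j + 1) ≤ b 0) (hli : up b j (i + 1) ≤ b 0) :
    coeffU (up (up b j) i) = coeffU (dsShift (dsShift b)) + secA b i j * coeffU (dsShift b) + secB b i j * coeffU b ∧
    coeffW (up (up b j) i) = coeffW (dsShift (dsShift b)) + secA b i j * coeffW (dsShift b) + secB b i j * coeffW b ∧
    coeffV (up (up b j) i) = coeffV (dsShift (dsShift b)) + secA b i j * coeffV (dsShift b) + secB b i j * coeffV b := by
  obtain ⟨hbj, hdj, hlij⟩ := ds_hyps_up b hb hd hj hlj hli
  obtain ⟨hbp, hdp, hljp⟩ := ds_hyps_dsShift b hb hd hj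
  obtain ⟨U1, W1, V1⟩ := dictionary_dsShift (up b j) hbj hdj hi hlij
  obtain ⟨U2, W2, V2⟩ := dictionary_dsShift (dsShift b) hbp hdp hj hljp
  obtain ⟨U3, W3, V3⟩ := dictionary_dsShift b hb (by omega) hj hlj
  rw [dsShift_up] at U1 W1 V1
  unfold up at U1 W1 V1
  unfold secA secB up
  exact ⟨by linear_combination (-1 : ℚ) * U1 - U2 - dsLam (Function.update b (j + 1) (b (j + 1) + 1)) i * U3,
    by linear_combination (-1 : ℚ) * W1 - W2 - dsLam (Function.update b (j + 1) (b (j + 1) + 1)) i * W3,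
    by linear_combination (-1 : ℚ) * V1 - V2 - dsLam (Function.update b (j + 1) (b (j + 1) + 1)) i * V3⟩

/-- **Second-shell expansion, vector form:** `v(b + e_{i+1} + e_{j+1}) = v(b⁺⁺) + A_{ij} • v(b⁺) + B_{ij} • v(b)`. -/
theorem typeI_up_up (b : ℕ → ℤ) (hb : InBox b) (hd : 1 ≤ dOf b) {i j : ℕ} (hi : i ∈ range 7)
    (hj : j ∈ range 7) (hlj : b (j + 1) ≤ b 0) (hli : up b j (i + 1) ≤ b 0) :
    typeI (up (up b j) i) = typeI (dsShift (dsShift b)) + secA b i j • typeI (dsShift b) + secB b i j • typeI b := by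
  obtain ⟨hU, hW, hV⟩ := dictionary_up_up b hb hd hi hj hlj hli
  ext k
  fin_cases k <;> simp [typeI, hU, hW, hV]

/-- The first shell in the same frame (E-L12's `typeI_dsShift`, rearranged): `v(b + e_{k+1}) = v(b⁺) + λ_k • v(b)`. -/
theorem typeI_up (b : ℕ → ℤ) (hb : InBox b) (hd : 0 ≤ dOf b) {k : ℕ} (hk : k ∈ range 7) (hlk : b (k + 1) ≤ b 0) :
    typeI (up b k) = typeI (dsShift b) + dsLam b k • typeI b := by
  rw [typeI_dsShift b hb hd hk hlk, sub_add_cancel]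

/-! ### One determinant for all (base, first-shell, second-shell) triples -/

/-- The diagonal Casoratian `det[v(b), v(b⁺), v(b⁺⁺)]` — the `3 × 3` determinant of the diagonal 3-frame. -/
def diagCasoratian (b : ℕ → ℤ) : ℚ := (Matrix.of ![typeI b, typeI (dsShift b), typeI (dsShift (dsShift b))]).det

/-- **All mixed-shell triples have the determinant of the diagonal frame:**
`det[v(b), v(b + e_{k+1}), v(b + e_{i+1} + e_{j+1})] = det[v(b), v(b⁺), v(b⁺⁺)]` for all admissible `k, i, j`
(the change of frame is unitriangular).  In particular no such triple is degenerate unless the diagonal frame is, and the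
second shell is NOT in the plane `Π(b)` of E-L10 unless `diagCasoratian b = 0`. -/
theorem det_shells_eq_diagCasoratian (b : ℕ → ℤ) (hb : InBox b) (hd : 1 ≤ dOf b) {i j k : ℕ} (hi : i ∈ range 7)
    (hj : j ∈ range 7) (hk : k ∈ range 7) (hlj : b (j + 1) ≤ b 0) (hli : up b j (i + 1) ≤ b 0)
    (hlk : b (k + 1) ≤ b 0) :
    (Matrix.of ![typeI b, typeI (up b k), typeI (up (up b j) i)]).det = diagCasoratian b := by
  obtain ⟨hU, hW, hV⟩ := dictionary_up_up b hb hd hi hj hlj hli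
  obtain ⟨kU, kW, kV⟩ := dictionary_dsShift b hb (by omega) hk hlk
  have kU' : coeffU (up b k) = coeffU (dsShift b) + dsLam b k * coeffU b := by
    unfold up; linear_combination (-1 : ℚ) * kU
  have kW' : coeffW (up b k) = coeffW (dsShift b) + dsLam b k * coeffW b := by
    unfold up; linear_combination (-1 : ℚ) * kW
  have kV' : coeffV (up b k) = coeffV (dsShift b) + dsLam b k * coeffV b := by
    unfold up; linear_combination (-1 : ℚ) * kV
  unfold diagCasoratian
  rw [Matrix.det_fin_three, Matrix.det_fin_three]
  simp only [Matrix.of_apply, Matrix.cons_val_zero, Matrix.cons_val_one, Matrix.cons_val_two,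
    Matrix.head_cons, Matrix.tail_cons, typeI]
  rw [hU, hW, hV, kU', kW', kV']
  ring

/-- Differences within the second shell lie in the plane `Π(b) = ⟨v(b), v(b⁺)⟩`:
`v(b + e_{i+1} + e_{j+1}) − v(b + e_{k+1} + e_{l+1}) = (A_{ij} − A_{kl}) • v(b⁺) + (B_{ij} − B_{kl}) • v(b)`. -/
theorem typeI_up_up_sub (b : ℕ → ℤ) (hb : InBox b) (hd : 1 ≤ dOf b) {i j k l : ℕ} (hi : i ∈ range 7)
    (hj : j ∈ range 7) (hk : k ∈ range 7) (hl : l ∈ range 7) (hlj : b (j + 1) ≤ b 0) (hli : up b j (i + 1) ≤ b 0)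
    (hll : b (l + 1) ≤ b 0) (hlk : up b l (k + 1) ≤ b 0) :
    typeI (up (up b j) i) - typeI (up (up b l) k) =
      (secA b i j - secA b k l) • typeI (dsShift b) + (secB b i j - secB b k l) • typeI b := by
  rw [typeI_up_up b hb hd hi hj hlj hli, typeI_up_up b hb hd hk hl hll hlk]; module

/-! ### Generic pair objects: minors and the `ζ(3)`-eliminant of an arbitrary pair `(b, b′)` -/

/-- `ζ(5)`-coefficient minor of the pair `(b, b′)`: `U(b)W(b′) − U(b′)W(b)`. -/
def pairMinorQ (b b' : ℕ → ℤ) : ℚ := coeffU b * coeffW b' - coeffU b' * coeffW b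

/-- `ζ(3)`-side companion minor of the pair: `U(b)V(b′) − U(b′)V(b)`. -/
def pairMinorPhat (b b' : ℕ → ℤ) : ℚ := coeffU b * coeffV b' - coeffU b' * coeffV b

/-- Constant-term minor of the pair: `W(b′)V(b) − W(b)V(b′)`. -/
def pairMinorP (b b' : ℕ → ℤ) : ℚ := coeffW b' * coeffV b - coeffW b * coeffV b'

/-- The `ζ(3)`-ELIMINANT of the pair `(b, b′)`: `W(b′)·F̃₇(b) − W(b)·F̃₇(b′)` (a real number). -/
def pairElim (b b' : ℕ → ℤ) : ℝ := (coeffW b' : ℝ) * vwpDual 7 b - (coeffW b : ℝ) * vwpDual 7 b'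

/-- E-L10's contiguous objects are the pair objects of `(b, b + e_{i+1})` … -/
theorem contiguous_eq_pair (b : ℕ → ℤ) (i : ℕ) :
    minorQ b i = pairMinorQ b (up b i) ∧ minorPhat b i = pairMinorPhat b (up b i) ∧
      minorP b i = pairMinorP b (up b i) ∧ partnerElim b i = pairElim b (up b i) :=
  ⟨rfl, rfl, rfl, rfl⟩

/-- … and E-L12's diagonal objects are the pair objects of `(b, b⁺)`. -/
theorem diag_eq_pair (b : ℕ → ℤ) :
    diagMinorQ b = pairMinorQ b (dsShift b) ∧ diagMinorPhat b = pairMinorPhat b (dsShift b) ∧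
      diagMinorP b = pairMinorP b (dsShift b) ∧ diagElim b = pairElim b (dsShift b) :=
  ⟨rfl, rfl, rfl, rfl⟩

/-- **Every pair eliminant of two in-box shapes of admissible degree is `ζ(3)`-free**, with the pair's own minors as
coefficients: `W(b′)F̃₇(b) − W(b)F̃₇(b′) = [U(b)W(b′) − U(b′)W(b)]·ζ(5) − [W(b′)V(b) − W(b)V(b′)]`. -/
theorem pairElim_eq (b b' : ℕ → ℤ) (hb : InBox b) (hs : ∑ j ∈ range 7, b (j + 1) ≤ 3 * b 0 + 1) (hb' : InBox b')
    (hs' : ∑ j ∈ range 7, b' (j + 1) ≤ 3 * b' 0 + 1) :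
    pairElim b b' = (pairMinorQ b b' : ℝ) * zetaValue 5 - (pairMinorP b b' : ℝ) := by
  have h0 := (vwp_decomposition b hb hs).2
  have h1 := (vwp_decomposition b' hb' hs').2
  unfold pairElim pairMinorQ pairMinorP
  rw [h0, h1]
  push_cast
  ring

/-! ### The second-shell pair = the stride-two diagonal pair + `A_{ij}` × Brown–Zudilin -/

/-- `U(b)W(b″) − U(b″)W(b) = [U(b)W(b⁺⁺) − U(b⁺⁺)W(b)] + A_{ij}·[U(b)W(b⁺) − U(b⁺)W(b)]` for `b″ = b + e_{i+1} + e_{j+1}`. -/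
theorem pairMinorQ_up_up (b : ℕ → ℤ) (hb : InBox b) (hd : 1 ≤ dOf b) {i j : ℕ} (hi : i ∈ range 7)
    (hj : j ∈ range 7) (hlj : b (j + 1) ≤ b 0) (hli : up b j (i + 1) ≤ b 0) :
    pairMinorQ b (up (up b j) i) = pairMinorQ b (dsShift (dsShift b)) + secA b i j * diagMinorQ b := by
  obtain ⟨hU, hW, -⟩ := dictionary_up_up b hb hd hi hj hlj hli
  unfold pairMinorQ diagMinorQ
  rw [hU, hW]
  ring

/-- The same for the companion minor `P̂`. -/
theorem pairMinorPhat_up_up (b : ℕ → ℤ) (hb : InBox b) (hd : 1 ≤ dOf b) {i j : ℕ} (hi : i ∈ range 7)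
    (hj : j ∈ range 7) (hlj : b (j + 1) ≤ b 0) (hli : up b j (i + 1) ≤ b 0) :
    pairMinorPhat b (up (up b j) i) = pairMinorPhat b (dsShift (dsShift b)) + secA b i j * diagMinorPhat b := by
  obtain ⟨hU, -, hV⟩ := dictionary_up_up b hb hd hi hj hlj hli
  unfold pairMinorPhat diagMinorPhat
  rw [hU, hV]
  ring

/-- The same for the constant-term minor `P`. -/
theorem pairMinorP_up_up (b : ℕ → ℤ) (hb : InBox b) (hd : 1 ≤ dOf b) {i j : ℕ} (hi : i ∈ range 7)
    (hj : j ∈ range 7) (hlj : b (j + 1) ≤ b 0) (hli : up b j (i + 1) ≤ b 0) :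
    pairMinorP b (up (up b j) i) = pairMinorP b (dsShift (dsShift b)) + secA b i j * diagMinorP b := by
  obtain ⟨-, hW, hV⟩ := dictionary_up_up b hb hd hi hj hlj hli
  unfold pairMinorP diagMinorP
  rw [hW, hV]
  ring

/-- **(DS) for the form, second shell:** `F̃₇(b + e_{i+1} + e_{j+1}) = F̃₇(b⁺⁺) + A_{ij}·F̃₇(b⁺) + B_{ij}·F̃₇(b)`. -/
theorem vwpDual_up_up (b : ℕ → ℤ) (hb : InBox b) (hd : 1 ≤ dOf b) {i j : ℕ} (hi : i ∈ range 7)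
    (hj : j ∈ range 7) (hlj : b (j + 1) ≤ b 0) (hli : up b j (i + 1) ≤ b 0) :
    vwpDual 7 (up (up b j) i) =
      vwpDual 7 (dsShift (dsShift b)) + (secA b i j : ℝ) * vwpDual 7 (dsShift b) + (secB b i j : ℝ) * vwpDual 7 b := by
  obtain ⟨hbj, hdj, hlij⟩ := ds_hyps_up b hb hd hj hlj hli
  obtain ⟨hbp, hdp, hljp⟩ := ds_hyps_dsShift b hb hd hj
  have F1 := vwpDual_dsShift (up b j) hbj hdj hi hlij
  have F2 := vwpDual_dsShift (dsShift b) hbp hdp hj hljp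
  have F3 := vwpDual_dsShift b hb (by omega) hj hlj
  rw [dsShift_up] at F1
  unfold secA secB
  push_cast
  linear_combination (-1 : ℝ) * F1 - F2 - (dsLam (up b j) i : ℝ) * F3

/-- **The second-shell eliminant = the stride-two diagonal eliminant + `A_{ij}` × Brown–Zudilin's:**
`E(b, b + e_{i+1} + e_{j+1}) = E(b, b⁺⁺) + A_{ij}·diagElim b` (and `diagElim b = partnerElim b ·`, E-L12). -/
theorem pairElim_up_up (b : ℕ → ℤ) (hb : InBox b) (hd : 1 ≤ dOf b) {i j : ℕ} (hi : i ∈ range 7)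
    (hj : j ∈ range 7) (hlj : b (j + 1) ≤ b 0) (hli : up b j (i + 1) ≤ b 0) :
    pairElim b (up (up b j) i) = pairElim b (dsShift (dsShift b)) + (secA b i j : ℝ) * diagElim b := by
  obtain ⟨-, hW, -⟩ := dictionary_up_up b hb hd hi hj hlj hli
  have hF := vwpDual_up_up b hb hd hi hj hlj hli
  unfold pairElim diagElim
  rw [hF, hW]
  push_cast
  ring

/-! ### Plücker: the stride-two pair in terms of the two consecutive diagonal pairs -/

/-- **Three-term identity for the eliminants (no hypotheses):**
`W(b⁺)·E(b, b⁺⁺) = W(b⁺⁺)·E(b, b⁺) + W(b)·E(b⁺, b⁺⁺)`. -/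
theorem plucker_pairElim (b : ℕ → ℤ) :
    (coeffW (dsShift b) : ℝ) * pairElim b (dsShift (dsShift b)) =
      (coeffW (dsShift (dsShift b)) : ℝ) * diagElim b + (coeffW b : ℝ) * diagElim (dsShift b) := by
  unfold pairElim diagElim
  ring

/-- The same identity for the `ζ(5)`-coefficient minors: `W(b⁺)·Q(b, b⁺⁺) = W(b⁺⁺)·Q(b, b⁺) + W(b)·Q(b⁺, b⁺⁺)`. -/
theorem plucker_pairMinorQ (b : ℕ → ℤ) :
    coeffW (dsShift b) * pairMinorQ b (dsShift (dsShift b)) =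
      coeffW (dsShift (dsShift b)) * diagMinorQ b + coeffW b * diagMinorQ (dsShift b) := by
  unfold pairMinorQ diagMinorQ
  ring

/-- The same identity for the constant-term minors: `W(b⁺)·P(b, b⁺⁺) = W(b⁺⁺)·P(b, b⁺) + W(b)·P(b⁺, b⁺⁺)`. -/
theorem plucker_pairMinorP (b : ℕ → ℤ) :
    coeffW (dsShift b) * pairMinorP b (dsShift (dsShift b)) =
      coeffW (dsShift (dsShift b)) * diagMinorP b + coeffW b * diagMinorP (dsShift b) := by
  unfold pairMinorP diagMinorP
  ring

/-! ### Conclusion: the stride-two and second-shell eliminants in the span of two consecutive Brown–Zudilin eliminants -/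

/-- **The stride-two diagonal eliminant is a fixed rational combination of Brown–Zudilin's eliminants at `b` and `b⁺`:**
`W(b⁺) · [W(b⁺⁺)F̃₇(b) − W(b)F̃₇(b⁺⁺)] = W(b⁺⁺)·partnerElim b j + W(b)·partnerElim b⁺ j` for any admissible slot `j`
(`d(b) ≥ 1`, `b_{j+1} ≤ b₀`). -/
theorem strideTwo_elim_eq (b : ℕ → ℤ) (hb : InBox b) (hd : 1 ≤ dOf b) {j : ℕ} (hj : j ∈ range 7)
    (hlj : b (j + 1) ≤ b 0) :
    (coeffW (dsShift b) : ℝ) * pairElim b (dsShift (dsShift b)) =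
      (coeffW (dsShift (dsShift b)) : ℝ) * partnerElim b j + (coeffW b : ℝ) * partnerElim (dsShift b) j := by
  obtain ⟨hbp, hdp, hljp⟩ := ds_hyps_dsShift b hb hd hj
  rw [plucker_pairElim, diagElim_eq_partnerElim b hb (by omega) hj hlj, diagElim_eq_partnerElim (dsShift b) hbp hdp hj hljp]

/-- **Every second-shell eliminant is a fixed rational combination of Brown–Zudilin's eliminants at `b` and `b⁺`:**
`W(b⁺) · [W(b″)F̃₇(b) − W(b)F̃₇(b″)] = (W(b⁺⁺) + A_{ij}W(b⁺))·partnerElim b j + W(b)·partnerElim b⁺ j`,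
`b″ = b + e_{i+1} + e_{j+1}`. -/
theorem secondShell_elim_eq (b : ℕ → ℤ) (hb : InBox b) (hd : 1 ≤ dOf b) {i j : ℕ} (hi : i ∈ range 7)
    (hj : j ∈ range 7) (hlj : b (j + 1) ≤ b 0) (hli : up b j (i + 1) ≤ b 0) :
    (coeffW (dsShift b) : ℝ) * pairElim b (up (up b j) i) =
      ((coeffW (dsShift (dsShift b)) : ℝ) + (secA b i j : ℝ) * coeffW (dsShift b)) * partnerElim b j +
        (coeffW b : ℝ) * partnerElim (dsShift b) j := by
  rw [pairElim_up_up b hb hd hi hj hlj hli, mul_add, strideTwo_elim_eq b hb hd hj hlj,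
    diagElim_eq_partnerElim b hb (by omega) hj hlj]
  ring

/-- The same statement with Brown–Zudilin's minors spelled out: as a linear form in `1, ζ(5)`,
`W(b⁺) · E(b, b″) = [c₁Q_j(b) + c₂Q_j(b⁺)]·ζ(5) − [c₁P_j(b) + c₂P_j(b⁺)]`, `c₁ = W(b⁺⁺) + A_{ij}W(b⁺)`, `c₂ = W(b)`. -/
theorem secondShell_elim_eq_minors (b : ℕ → ℤ) (hb : InBox b) (hd : 1 ≤ dOf b) {i j : ℕ} (hi : i ∈ range 7)
    (hj : j ∈ range 7) (hlj : b (j + 1) ≤ b 0) (hli : up b j (i + 1) ≤ b 0) :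
    (coeffW (dsShift b) : ℝ) * pairElim b (up (up b j) i) =
      (((coeffW (dsShift (dsShift b)) + secA b i j * coeffW (dsShift b)) * minorQ b j
          + coeffW b * minorQ (dsShift b) j : ℚ) : ℝ) * zetaValue 5 -
        (((coeffW (dsShift (dsShift b)) + secA b i j * coeffW (dsShift b)) * minorP b j
          + coeffW b * minorP (dsShift b) j : ℚ) : ℝ) := by
  obtain ⟨hbp, hdp, hljp⟩ := ds_hyps_dsShift b hb hd hj
  rw [secondShell_elim_eq b hb hd hi hj hlj hli, partnerElim_eq b hb (by omega) hj hlj,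
    partnerElim_eq (dsShift b) hbp hdp hj hljp]
  push_cast
  ring

end Summit.KontsevichZagierPeriods.Zeta5Search.Elimination

end
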